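import Summits.RiemannHypothesis.RiemannHypothesis.Theses.WeilComb
import Summits.RiemannHypothesis.RiemannHypothesis.Theorems.CombSubcritical.Negative.WeilCombCombSubcriticalLoadBearing
import Literature.NumberTheory.LFunctions.WeilExplicit
import Literature.NumberTheory.LFunctions.WeilArchimedeanMoments
import Literature.NumberTheory.LFunctions.WeilArchimedeanPositivityProofs
import Literature.NumberTheory.LFunctions.WeilMellinBounds
import Literature.NumberTheory.LFunctions.WeilWindowSimpleEven
import Literature.NumberTheory.LFunctions.WeilGroundEnergyProofs

/-!
# Stub `stub_polar` of line `helson-dirichlet-slack` for crux `WeilComb.CombSubcritical`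
(item stmt-RiemannHypothesis-1025, route route-RiemannHypothesis-WeilComb)

The polar term of the comb autocorrelation. Let `φ` be a Weil test function with
`tsupport φ ⊆ [-1, 1]`, `0 < ε ≤ 1/8`, `φ_ε = ε⁻¹ φ(·/ε)` and
`g(x) = Σ_{1 ≤ m ≤ M} a_m φ_ε(x − log m)` the log-integer comb. With `k = g ⋆ g̃` we prove

`Re (k̂(0) + k̂(1)) ≥ −5 ‖φ‖₂² A₋ A₊`, `A₋ = Σ ‖a_m‖ m^{-1/2}`, `A₊ = Σ ‖a_m‖ m^{1/2}`.

Proof. By `weilPolarTerm_weilConv_weilReflect`, `k̂(0) + k̂(1) = 2 Re(ĝ(0) conj ĝ(1))`, so the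
real part is at least `−2 ‖ĝ(0)‖ ‖ĝ(1)‖`. Linearity of the transform and the translation rule
`(τ_x h)^(s) = e^{(s − 1/2) x} ĥ(s)` give `ĝ(s) = (Σ a_m m^{s − 1/2}) φ̂_ε(s)`, whence
`‖ĝ(0)‖ ≤ A₋ ‖φ̂_ε(0)‖` and `‖ĝ(1)‖ ≤ A₊ ‖φ̂_ε(1)‖`. Since `tsupport φ_ε ⊆ [−ε, ε]`, the crude
bound `‖φ̂_ε(c + 1/2)‖ ≤ e^{|Re c| ε} ‖φ_ε‖₁` at `c = ∓1/2` and `‖φ_ε‖₁ = ‖φ‖₁` give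
`‖φ̂_ε(0)‖, ‖φ̂_ε(1)‖ ≤ e^{ε/2} ‖φ‖₁`. Finally `‖φ‖₁² ≤ 2 ‖φ‖₂²` (Cauchy–Schwarz on `[-1, 1]`)
and `e^{ε} ≤ 5/4` for `ε ≤ 1/8`, so `2 ‖ĝ(0)‖ ‖ĝ(1)‖ ≤ 2 e^{ε} ‖φ‖₁² A₋ A₊ ≤ 5 ‖φ‖₂² A₋ A₊`.
-/

noncomputable section

open scoped BigOperators ComplexConjugate
open Complex MeasureTheory Set

namespace Summit.RiemannHypothesis.RiemannHypothesis.Theorems.WeilCombSubcritical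

open Literature.NumberTheory.LFunctions

/-! ### Private toolkit: the dilation `φ_ε` and the transform of the comb -/

/-- `φ_ε` is a Weil test function (`ε ≠ 0`). -/
private theorem isWeilTest_dil_polar {φ : ℝ → ℂ} {ε : ℝ} (hφ : IsWeilTest φ) (hε : ε ≠ 0) :
    IsWeilTest (fun t : ℝ => (ε : ℂ)⁻¹ * φ (t / ε)) := by
  have h1 : IsWeilTest (fun t : ℝ => φ (t / ε)) := by
    refine ⟨hφ.1.comp (contDiff_id.div_const ε), ?_⟩
    have e : (fun t : ℝ => φ (t / ε)) = φ ∘ (Homeomorph.mulRight₀ ε⁻¹ (inv_ne_zero hε)) := by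
      ext t
      simp [div_eq_mul_inv]
    rw [e]
    exact hφ.2.comp_homeomorph _
  exact h1.const_mul _

/-- `tsupport φ ⊆ [-1, 1]` gives `tsupport φ_ε ⊆ [-ε, ε]` (`ε > 0`). -/
private theorem tsupport_dil_subset_polar {φ : ℝ → ℂ} {ε : ℝ} (hsupp : tsupport φ ⊆ Icc (-1) 1)
    (hε : 0 < ε) : tsupport (fun t : ℝ => (ε : ℂ)⁻¹ * φ (t / ε)) ⊆ Icc (-ε) ε := by
  refine closure_minimal ?_ isClosed_Icc
  intro t ht
  rw [Function.mem_support] at ht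
  have hφ : φ (t / ε) ≠ 0 := fun h => ht (by simp [h])
  have hmem : t / ε ∈ Icc (-1 : ℝ) 1 := hsupp (subset_tsupport _ hφ)
  constructor
  · have h := hmem.1
    rw [le_div_iff₀ hε] at h
    linarith
  · have h := hmem.2
    rw [div_le_iff₀ hε] at h
    linarith

/-- `‖φ_ε‖₁ = ‖φ‖₁` (`ε > 0`). -/
private theorem weilNorm1_dil_polar (φ : ℝ → ℂ) {ε : ℝ} (hε : 0 < ε) :
    weilNorm1 (fun t : ℝ => (ε : ℂ)⁻¹ * φ (t / ε)) = weilNorm1 φ := by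
  unfold weilNorm1
  have e : (fun t : ℝ => ‖(ε : ℂ)⁻¹ * φ (t / ε)‖) = fun t => ε⁻¹ * ‖φ (t / ε)‖ := by
    funext t
    rw [norm_mul, norm_inv, Complex.norm_real, Real.norm_eq_abs, abs_of_pos hε]
  rw [e, integral_const_mul, Measure.integral_comp_div (fun t => ‖φ t‖) ε, abs_of_pos hε,
    smul_eq_mul, ← mul_assoc, inv_mul_cancel₀ hε.ne', one_mul]

/-- `‖φ̂_ε(c + 1/2)‖ ≤ e^{ε/2} ‖φ‖₁` for `c = ±1/2` real with `|c| = 1/2`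
(`tsupport φ ⊆ [-1, 1]`, `ε > 0`). -/
private theorem norm_weilMellin_dil_le_polar {φ : ℝ → ℂ} (hφ : IsWeilTest φ)
    (hsupp : tsupport φ ⊆ Icc (-1) 1) {ε : ℝ} (hε : 0 < ε) {c : ℝ} (hc : |c| = 1 / 2) :
    ‖weilMellin (fun t : ℝ => (ε : ℂ)⁻¹ * φ (t / ε)) ((c : ℂ) + 1 / 2)‖ ≤
      Real.exp (ε / 2) * weilNorm1 φ := by
  have h := norm_weilMellin_add_half_le (isWeilTest_dil_polar hφ hε.ne')
    (tsupport_dil_subset_polar hsupp hε) (c : ℂ)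
  rw [Complex.ofReal_re, hc, weilNorm1_dil_polar φ hε] at h
  convert h using 2
  ring

/-- `e^{(log x)/2} = √x` for `x > 0`. -/
private theorem exp_log_half_polar {x : ℝ} (hx : 0 < x) :
    Real.exp (Real.log x / 2) = Real.sqrt x := by
  rw [Real.sqrt_eq_rpow, Real.rpow_def_of_pos hx]
  congr 1
  ring

/-- Transform of the comb: `ĝ(s) = (Σ_m a_m e^{(s − 1/2) log m}) φ̂_ε(s)` (linearity and the
translation rule `weilMellin_weilTranslate`). -/
private theorem weilMellin_comb_polar {φ : ℝ → ℂ} (hφ : IsWeilTest φ) {ε : ℝ} (hε : ε ≠ 0)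
    (M : ℕ) (a : ℕ → ℂ) (s : ℂ) :
    weilMellin (fun x : ℝ => ∑ m ∈ Finset.Icc 1 M,
        a m * ((ε : ℂ)⁻¹ * φ ((x - Real.log (m : ℝ)) / ε))) s =
      (∑ m ∈ Finset.Icc 1 M, a m * cexp ((s - 1 / 2) * (Real.log (m : ℝ) : ℂ))) *
        weilMellin (fun t : ℝ => (ε : ℂ)⁻¹ * φ (t / ε)) s := by
  set φε : ℝ → ℂ := fun t : ℝ => (ε : ℂ)⁻¹ * φ (t / ε) with hφε
  have hW : IsWeilTest φε := isWeilTest_dil_polar hφ hε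
  have hint : ∀ m ∈ Finset.Icc 1 M, Integrable (fun t : ℝ =>
      a m * (weilTranslate φε (Real.log (m : ℝ)) t * cexp ((s - 1 / 2) * t))) := by
    intro m _
    have hT : IsWeilTest (weilTranslate φε (Real.log (m : ℝ))) := hW.weilTranslate _
    exact (integrable_weilIntegrand hT.1.continuous hT.2 s).const_mul (a m)
  calc weilMellin (fun x : ℝ => ∑ m ∈ Finset.Icc 1 M,
          a m * ((ε : ℂ)⁻¹ * φ ((x - Real.log (m : ℝ)) / ε))) s
      = ∫ t : ℝ, ∑ m ∈ Finset.Icc 1 M,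
          a m * (weilTranslate φε (Real.log (m : ℝ)) t * cexp ((s - 1 / 2) * t)) := by
        unfold weilMellin
        congr 1 with t
        rw [Finset.sum_mul]
        refine Finset.sum_congr rfl fun m _ => ?_
        simp only [weilTranslate, hφε]
        ring
    _ = ∑ m ∈ Finset.Icc 1 M, ∫ t : ℝ,
          a m * (weilTranslate φε (Real.log (m : ℝ)) t * cexp ((s - 1 / 2) * t)) :=
        integral_finsetSum _ hint
    _ = ∑ m ∈ Finset.Icc 1 M,
          a m * (cexp ((s - 1 / 2) * (Real.log (m : ℝ) : ℂ)) * weilMellin φε s) := by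
        refine Finset.sum_congr rfl fun m _ => ?_
        rw [integral_const_mul, ← weilMellin_weilTranslate]
        rfl
    _ = (∑ m ∈ Finset.Icc 1 M, a m * cexp ((s - 1 / 2) * (Real.log (m : ℝ) : ℂ))) *
          weilMellin φε s := by
        rw [Finset.sum_mul]
        refine Finset.sum_congr rfl fun m _ => ?_
        ring

/-- The Dirichlet polynomial at `s = 0`: `‖Σ a_m e^{-(log m)/2}‖ ≤ Σ ‖a_m‖ / √m`. -/
private theorem norm_dirichlet_zero_le_polar (M : ℕ) (a : ℕ → ℂ) :
    ‖∑ m ∈ Finset.Icc 1 M, a m * cexp (((0 : ℂ) - 1 / 2) * (Real.log (m : ℝ) : ℂ))‖ ≤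
      ∑ m ∈ Finset.Icc 1 M, ‖a m‖ / Real.sqrt m := by
  refine (norm_sum_le _ _).trans (le_of_eq (Finset.sum_congr rfl fun m hm => ?_))
  have hm0 : (0 : ℝ) < m := by
    have h1 : (1 : ℝ) ≤ m := by exact_mod_cast (Finset.mem_Icc.1 hm).1
    linarith
  have e : ((0 : ℂ) - 1 / 2) * (Real.log (m : ℝ) : ℂ) = ((-(Real.log (m : ℝ) / 2) : ℝ) : ℂ) := by
    push_cast
    ring
  rw [norm_mul, e, Complex.norm_exp_ofReal, Real.exp_neg, exp_log_half_polar hm0,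
    div_eq_mul_inv]

/-- The Dirichlet polynomial at `s = 1`: `‖Σ a_m e^{(log m)/2}‖ ≤ Σ ‖a_m‖ √m`. -/
private theorem norm_dirichlet_one_le_polar (M : ℕ) (a : ℕ → ℂ) :
    ‖∑ m ∈ Finset.Icc 1 M, a m * cexp (((1 : ℂ) - 1 / 2) * (Real.log (m : ℝ) : ℂ))‖ ≤
      ∑ m ∈ Finset.Icc 1 M, ‖a m‖ * Real.sqrt m := by
  refine (norm_sum_le _ _).trans (le_of_eq (Finset.sum_congr rfl fun m hm => ?_))
  have hm0 : (0 : ℝ) < m := by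
    have h1 : (1 : ℝ) ≤ m := by exact_mod_cast (Finset.mem_Icc.1 hm).1
    linarith
  have e : ((1 : ℂ) - 1 / 2) * (Real.log (m : ℝ) : ℂ) = ((Real.log (m : ℝ) / 2 : ℝ) : ℂ) := by
    push_cast
    ring
  rw [norm_mul, e, Complex.norm_exp_ofReal, exp_log_half_polar hm0]

/-- `e^{ε} ≤ 5/4` for `0 ≤ ε ≤ 1/8` (from `1 − ε ≤ e^{−ε}`), in the form
`e^{ε/2} e^{ε/2} ≤ 5/4`. -/
private theorem exp_half_mul_self_le_polar {ε : ℝ} (hε8 : ε ≤ 1 / 8) :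
    Real.exp (ε / 2) * Real.exp (ε / 2) ≤ 5 / 4 := by
  rw [← Real.exp_add, add_halves]
  have h1 := Real.add_one_le_exp (-ε)
  have h2 : Real.exp ε * Real.exp (-ε) = 1 := by
    rw [← Real.exp_add, add_neg_cancel, Real.exp_zero]
  nlinarith [Real.exp_pos ε, Real.exp_pos (-ε)]

/-- **Stub 7a — the polar term of the comb autocorrelation.**  For a Weil test `φ` supported in
`[-1, 1]`, `0 < ε ≤ 1/8` and the comb `g`: `Re (k̂(0) + k̂(1)) ≥ −5 ‖φ‖₂² A₋ A₊`, `k = g ⋆ g̃`,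
`A₋ = Σ ‖a_m‖ m^{-1/2}`, `A₊ = Σ ‖a_m‖ m^{1/2}` (`k̂(0) + k̂(1) = 2 Re(ĝ(0) conj ĝ(1))`,
`ĝ(s) = φ̂_ε(s) Σ a_m m^{s−1/2}`, `|φ̂_ε(0)|, |φ̂_ε(1)| ≤ e^{ε/2} ‖φ‖₁`, `‖φ‖₁² ≤ 2 ‖φ‖₂²`,
`4 e^{1/8} ≤ 5`). -/
theorem stub_polar :
    ∀ φ : ℝ → ℂ, IsWeilTest φ → tsupport φ ⊆ Set.Icc (-1) 1 →
      ∀ ε : ℝ, 0 < ε → ε ≤ 1 / 8 → ∀ (M : ℕ) (a : ℕ → ℂ),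
        -(5 * weilNorm2Sq φ * (∑ m ∈ Finset.Icc 1 M, ‖a m‖ / Real.sqrt m) *
            (∑ m ∈ Finset.Icc 1 M, ‖a m‖ * Real.sqrt m)) ≤
          (weilPolarTerm
            (weilConv (fun x : ℝ => ∑ m ∈ Finset.Icc 1 M,
                a m * ((ε : ℂ)⁻¹ * φ ((x - Real.log (m : ℝ)) / ε)))
              (weilReflect (fun x : ℝ => ∑ m ∈ Finset.Icc 1 M,
                a m * ((ε : ℂ)⁻¹ * φ ((x - Real.log (m : ℝ)) / ε)))))).re := by
  intro φ hφ hsupp ε hε hε8 M a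
  set φε : ℝ → ℂ := fun t : ℝ => (ε : ℂ)⁻¹ * φ (t / ε) with hφε
  set g : ℝ → ℂ := fun x : ℝ => ∑ m ∈ Finset.Icc 1 M,
    a m * ((ε : ℂ)⁻¹ * φ ((x - Real.log (m : ℝ)) / ε)) with hg
  set Am : ℝ := ∑ m ∈ Finset.Icc 1 M, ‖a m‖ / Real.sqrt m with hAm
  set Ap : ℝ := ∑ m ∈ Finset.Icc 1 M, ‖a m‖ * Real.sqrt m with hAp
  have hgW : IsWeilTest g := weilComb_isWeilTest_comb hφ hε.ne' M a
  rw [weilPolarTerm_weilConv_weilReflect hgW, Complex.ofReal_re]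
  have hAm0 : 0 ≤ Am := Finset.sum_nonneg fun m _ => by positivity
  have hAp0 : 0 ≤ Ap := Finset.sum_nonneg fun m _ => by positivity
  have hn1 : 0 ≤ weilNorm1 φ := weilNorm1_nonneg φ
  have hn12 : weilNorm1 φ ^ 2 ≤ 2 * weilNorm2Sq φ := by
    have h := weilNorm1_sq_le hφ one_pos hsupp
    linarith
  have hE2 : Real.exp (ε / 2) * Real.exp (ε / 2) ≤ 5 / 4 := exp_half_mul_self_le_polar hε8
  -- the transform of `φ_ε` at `0` and `1`
  have hM0 : ‖weilMellin φε 0‖ ≤ Real.exp (ε / 2) * weilNorm1 φ := by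
    have h := norm_weilMellin_dil_le_polar hφ hsupp hε (c := -(1 / 2))
      (by rw [abs_neg, abs_of_pos (by norm_num : (0 : ℝ) < 1 / 2)])
    have e : (((-(1 / 2) : ℝ) : ℂ) + 1 / 2) = 0 := by
      push_cast
      ring
    rwa [e] at h
  have hM1 : ‖weilMellin φε 1‖ ≤ Real.exp (ε / 2) * weilNorm1 φ := by
    have h := norm_weilMellin_dil_le_polar hφ hsupp hε (c := 1 / 2)
      (abs_of_pos (by norm_num : (0 : ℝ) < 1 / 2))
    have e : (((1 / 2 : ℝ) : ℂ) + 1 / 2) = 1 := by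
      push_cast
      ring
    rwa [e] at h
  -- the transform of the comb at `0` and `1`
  have hN0 : ‖weilMellin g 0‖ ≤ Am * (Real.exp (ε / 2) * weilNorm1 φ) := by
    rw [hg, weilMellin_comb_polar hφ hε.ne' M a 0, norm_mul]
    exact mul_le_mul (norm_dirichlet_zero_le_polar M a) hM0 (norm_nonneg _) hAm0
  have hN1 : ‖weilMellin g 1‖ ≤ Ap * (Real.exp (ε / 2) * weilNorm1 φ) := by
    rw [hg, weilMellin_comb_polar hφ hε.ne' M a 1, norm_mul]
    exact mul_le_mul (norm_dirichlet_one_le_polar M a) hM1 (norm_nonneg _) hAp0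
  -- assemble
  have hz : |(weilMellin g 0 * conj (weilMellin g 1)).re| ≤
      ‖weilMellin g 0‖ * ‖weilMellin g 1‖ := by
    calc |(weilMellin g 0 * conj (weilMellin g 1)).re|
        ≤ ‖weilMellin g 0 * conj (weilMellin g 1)‖ := Complex.abs_re_le_norm _
      _ = ‖weilMellin g 0‖ * ‖weilMellin g 1‖ := by rw [norm_mul, Complex.norm_conj]
  have hprod : ‖weilMellin g 0‖ * ‖weilMellin g 1‖ ≤ 5 / 2 * weilNorm2Sq φ * Am * Ap := by
    calc ‖weilMellin g 0‖ * ‖weilMellin g 1‖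
        ≤ (Am * (Real.exp (ε / 2) * weilNorm1 φ)) * (Ap * (Real.exp (ε / 2) * weilNorm1 φ)) :=
          mul_le_mul hN0 hN1 (norm_nonneg _) (by positivity)
      _ = (Real.exp (ε / 2) * Real.exp (ε / 2)) * weilNorm1 φ ^ 2 * (Am * Ap) := by ring
      _ ≤ (5 / 4) * (2 * weilNorm2Sq φ) * (Am * Ap) := by
          refine mul_le_mul_of_nonneg_right ?_ (mul_nonneg hAm0 hAp0)
          exact mul_le_mul hE2 hn12 (sq_nonneg _) (by norm_num)
      _ = 5 / 2 * weilNorm2Sq φ * Am * Ap := by ring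
  have hre := (abs_le.1 hz).1
  linarith

end Summit.RiemannHypothesis.RiemannHypothesis.Theorems.WeilCombSubcritical

end
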